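import Mathlib
import Literature.NumberTheory.Sieve.FordMaynardSieveBoundG1

/-!
# Route `FordMaynardSieveConst01651`, target `SieveConst01651` (stmt-Parity-19185), line `sieve_decomposition`:
# definitions `hfun` and `Admissible` (VERBATIM from the registered skeleton)

Definitions file (reviewed).  The registered skeleton `Cruxes/SieveConst01651/Lines/sieve_decomposition.lean` (v20,
sha16 `ce303863863cc0ea`) states its stubs over two objects it defines locally; to land the registered stub
`stub_hkPieces` BY NAME from a `Theorems` file (a `Lines` module is not importable) the two objects are declared here,
byte-for-byte the skeleton's bodies, so that the by-name theorem is the skeleton's statement up to the namespace of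
these two constants (definitionally equal; the lead replaces its local copies by this import):

* `hfun ν g k` — Ford–Maynard's main-term weight in dimension `k` (arXiv:2407.14368, proof of Lemma 7.20 / §6.2):
  the vector function equal to `𝟙[vᵢ > ν ∀ i]·(𝟙⋆g)(v)` in dimension `K = k` and `0` in every other dimension;
* `Admissible ν g` — the REPAIRED hypothesis bundle of Theorem 7.3 (a) at `P = (1/2, 0, ν)`: `g` symmetric, piecewise
  constant on convex polytopes of the ordered cone, `g(∅) = 1`, CLOSED support `{vᵢ > ν, ∑ vᵢ ≤ 1/2}` (FM's
  `𝒢₁ = {|𝐯| ≤ γ}`), and the sign clause `(𝟙⋆g) ≤ 0` on `{k ≥ 2, ν < vᵢ < 1 − ν, ∑ vᵢ = 1}`.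

Plus the two unfolding lemmas `hfun_apply`, `hfun_of_ne`; and (appended) the sieve-weight objects `pvec`, `roughPart`,
`smoothPart`, `Gwt`, `Hwt` of FM §7.2 (g-def)/(h-def), again VERBATIM the skeleton's, for helpers towards `stub_typeIIRegion`; and (appended) the window / roughness / `𝒩` / `ℛ` objects `window`, `IsRough`, `Nset`, `Rset` of the statement of `stub_typeIIRegion`, VERBATIM the skeleton's.  Nothing here proves anything about the Parity summit.
-/

noncomputable section

open Finset
open Literature.NumberTheory.Sieve Literature.NumberTheory.Sieve.FordMaynard

namespace Summit.Parity.GeneralizedHardyLittlewood.FordMaynardSieveConst01651SieveConst01651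

open scoped Classical in
/-- Ford–Maynard's main-term weight `h_k` (proof of Lemma 7.20, §6.2 form): in dimension `K = k` it is
`𝟙[vᵢ > ν ∀ i]·(𝟙⋆g)(v)`, in every other dimension `0`.  VERBATIM the skeleton's `hfun`
(`Cruxes/SieveConst01651/Lines/sieve_decomposition.lean`). [cite: FordMaynard2024PrimeSieves, Lemma 7.20 and §6.2] -/
def hfun (ν : ℝ) (g : VecFn) (k : ℕ) : VecFn :=
  fun K v => if K = k ∧ ∀ i, ν < v i then starSum g K v else 0

/-- The repaired clauses: symmetric, piecewise constant on the cone, `g(∅) = 1`, CLOSED support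
`{vᵢ > ν, ∑ vᵢ ≤ 1/2}`, sign clause on `{k ≥ 2, ν < vᵢ < 1 − ν, ∑ vᵢ = 1}`.  VERBATIM the skeleton's `Admissible`
(`Cruxes/SieveConst01651/Lines/sieve_decomposition.lean`). [cite: FordMaynard2024PrimeSieves, Theorem 7.3 (a) at P = (1/2, 0, ν)] -/
def Admissible (ν : ℝ) (g : VecFn) : Prop :=
  g.IsSymmetric ∧ IsPiecewiseConstOnCone g ∧ (∀ e : Fin 0 → ℝ, g 0 e = 1) ∧
    (∀ (k : ℕ) (x : Fin k → ℝ), g k x ≠ 0 → k = 0 ∨ ((∀ i, ν < x i) ∧ ∑ i, x i ≤ 1 / 2)) ∧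
    (∀ k : ℕ, 2 ≤ k → ∀ x : Fin k → ℝ, (∀ i, ν < x i ∧ x i < 1 - ν) → ∑ i, x i = 1 → starSum g k x ≤ 0)

open scoped Classical in
/-- Unfolding `hfun`. [cite: FordMaynard2024PrimeSieves, Lemma 7.20] -/
theorem hfun_apply (ν : ℝ) (g : VecFn) (k K : ℕ) (v : Fin K → ℝ) :
    hfun ν g k K v = if K = k ∧ ∀ i, ν < v i then starSum g K v else 0 := rfl

/-- `hfun ν g k` vanishes outside dimension `k`. [cite: FordMaynard2024PrimeSieves, Lemma 7.20] -/
theorem hfun_of_ne {ν : ℝ} {g : VecFn} {k K : ℕ} (hK : K ≠ k) (v : Fin K → ℝ) : hfun ν g k K v = 0 := by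
  rw [hfun_apply, if_neg (fun h => hK h.1)]

/-! ### The sieve weights (appended): `pvec`, `roughPart`, `smoothPart`, `Gwt`, `Hwt` — VERBATIM the skeleton's -/

/-- `𝐯(d; n)`: the vector of `log p / log n` over the prime factors `p` of `d` listed with multiplicity in
increasing order (`d.primeFactorsList`).  VERBATIM the skeleton's `pvec`.
[cite: FordMaynard2024PrimeSieves, §7.2 (the vectors 𝐯(d; n))] -/
def pvec (n d : ℕ) : Fin d.primeFactorsList.length → ℝ :=
  fun i => Real.log (d.primeFactorsList.get i) / Real.log n

/-- The `y`-rough part of `d`: the product of the prime powers `p ^ v_p(d)` over the primes `p ≥ y` of `d`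
(`= m₂` in `d = m₁ m₂`, `P⁺(m₁) < y ≤ P⁻(m₂)`).  VERBATIM the skeleton's `roughPart`.
[cite: FordMaynard2024PrimeSieves, §7.2 (g-def)] -/
def roughPart (y : ℝ) (d : ℕ) : ℕ :=
  ∏ p ∈ d.primeFactors.filter (fun p : ℕ => y ≤ (p : ℝ)), p ^ d.factorization p

/-- The `y`-smooth part `m₁ = d / m₂` of `d`.  VERBATIM the skeleton's `smoothPart`.
[cite: FordMaynard2024PrimeSieves, §7.2 (g-def)] -/
def smoothPart (y : ℝ) (d : ℕ) : ℕ := d / roughPart y d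

/-- Ford–Maynard's sieve weight `G(d; n) = 𝟙_{d ≤ n^{1/2}} μ(d₁) g(𝐯(d₂; n))`, `d = d₁ d₂` the smooth/rough
split at `y = n^ν` ((g-def) at `P = (1/2, 0, ν)`).  VERBATIM the skeleton's `Gwt`.
[cite: FordMaynard2024PrimeSieves, §7.2 (g-def)] -/
def Gwt (g : VecFn) (ν : ℝ) (n d : ℕ) : ℝ :=
  if (d : ℝ) ≤ (n : ℝ) ^ (1 / 2 : ℝ) then
    ((ArithmeticFunction.moebius (smoothPart ((n : ℝ) ^ ν) d) : ℤ) : ℝ) *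
      g _ (pvec n (roughPart ((n : ℝ) ^ ν) d))
  else 0

/-- Ford–Maynard's `H(n) = ∑_{d ∣ n} G(d; n)` ((h-def)).  VERBATIM the skeleton's `Hwt`.
[cite: FordMaynard2024PrimeSieves, §7.2 (h-def)] -/
def Hwt (g : VecFn) (ν : ℝ) (n : ℕ) : ℝ := ∑ d ∈ n.divisors, Gwt g ν n d

/-! ### The dyadic window and the Type-II region `ℛ` (appended; VERBATIM the skeleton's) -/

/-- The integers of the dyadic window `(x/2, x]`.  VERBATIM the skeleton's `window`.
[cite: FordMaynard2024PrimeSieves, §2 (sequences supported on `(x/2, x]`)] -/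
def window (x : ℝ) : Finset ℕ := (Icc 1 ⌊x⌋₊).filter (fun n : ℕ => x / 2 < (n : ℝ))

/-- `n` is `n^ν`-rough: every prime factor exceeds `n^ν` (`P⁻(n) > n^ν`).  VERBATIM the skeleton's `IsRough`.
[cite: FordMaynard2024PrimeSieves, §7.2 (N-def) and Lemma 7.18] -/
def IsRough (ν : ℝ) (n : ℕ) : Prop := ∀ p ∈ n.primeFactors, (n : ℝ) ^ ν < (p : ℝ)

/-- `𝒩`: the rough composites of the window.  VERBATIM the skeleton's `Nset`.
[cite: FordMaynard2024PrimeSieves, §7.2 (N-def)] -/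
def Nset (ν x : ℝ) : Finset ℕ := by
  classical exact (window x).filter (fun n => 2 ≤ n ∧ ¬ n.Prime ∧ IsRough ν n)

/-- `ℛ = (x/2, x] ∖ (𝒫 ∪ 𝒩)`: the non-prime, non-rough integers of the window — the range of summation of
Proposition 7.19.  VERBATIM the skeleton's `Rset`. [cite: FordMaynard2024PrimeSieves, Proposition 7.19] -/
def Rset (ν x : ℝ) : Finset ℕ := by
  classical exact (window x).filter (fun n => ¬ n.Prime ∧ ¬ (2 ≤ n ∧ IsRough ν n))

/-- Membership in the window. [cite: FordMaynard2024PrimeSieves, §2] -/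
theorem mem_window {x : ℝ} {n : ℕ} : n ∈ window x ↔ (1 ≤ n ∧ n ≤ ⌊x⌋₊) ∧ x / 2 < (n : ℝ) := by
  rw [window, mem_filter, mem_Icc]

/-- Membership in `𝒩`. [cite: FordMaynard2024PrimeSieves, §7.2 (N-def)] -/
theorem mem_Nset {ν x : ℝ} {n : ℕ} : n ∈ Nset ν x ↔ n ∈ window x ∧ 2 ≤ n ∧ ¬ n.Prime ∧ IsRough ν n := by
  classical
  rw [Nset, mem_filter]

/-- Membership in `ℛ`. [cite: FordMaynard2024PrimeSieves, Proposition 7.19] -/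
theorem mem_Rset {ν x : ℝ} {n : ℕ} : n ∈ Rset ν x ↔ n ∈ window x ∧ ¬ n.Prime ∧ ¬ (2 ≤ n ∧ IsRough ν n) := by
  classical
  rw [Rset, mem_filter]

end Summit.Parity.GeneralizedHardyLittlewood.FordMaynardSieveConst01651SieveConst01651

end
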